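import Literature.NumberTheory.EllipticCurves.Kato2004.LocPKummerLog
import Literature.NumberTheory.EllipticCurves.SelmerLocalConditionUnramifiedTorsion
import Literature.NumberTheory.EllipticCurves.ArchimedeanLocalCondition
import Literature.NumberTheory.EllipticCurves.SelmerImage
import Literature.NumberTheory.EllipticCurves.H1UnramifiedFinite
import HarnessLib

/-!
# Plumbing for the discharge of `Kato2004.locP_kernel_isTorsion_of_rankOne` (Kato 2004 §14.1 /
# (14.9.3) read in rank one): `⊤`-level bookkeeping on continuous `H¹`, the dialect bridge
# integral ⟹ unramified, the local inputs at `p`, `∞` and the bad places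

Topic `NumberTheory/EllipticCurves`, sub-directory `Kato2004` (namespace = path).  Cell `bsd-cn100`,
prover seat `bsd-cn100-s2-c3` (g9).  `Proofs`-style file: theorems only (no definition, no named
fact, no `sorry`, no instance).  Consumer: `Kato2004/LocPKernelRankOneProofs.lean`
(`locP_kernel_isTorsion_of_rankOne_holds`, the 11th conjunct of `stub_refereedInputs` of the
registered lines `kato-zeta-perrin-riou`, stmt-BirchSwinnertonDyer-19080 / -19160).

* §1 restriction along `⊤ ≤ U` for a subgroup `U` containing everything is injective
  (`eq_zero_of_resLe_top_eq_zero`); `Kato2004.layerZeroToTop` preserves integral classes, is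
  injective and `ℤ_p`-linear; `ofTopSubgroup` is injective (`eq_zero_of_ofTopSubgroup_eq_zero`);
* §2 the DIALECT BRIDGE (L3): an integral class of `H¹(⊤, W[n])` (vanishing on every `⊤ ⊓ I_𝔓`,
  `𝔓 ∤ p`), moved to `H¹(Γ_ℚ, W[n])` by `ofTopSubgroup`, lies in `unramifiedKer (W[n]) 𝔓`;
* §3 `res_v = 0 ⇒` local Selmer condition; the factor `2` at an infinite place; a homomorphism
  `λ : W(ℚ_v) → ℤ_p` (`v` the place above `p`) vanishing exactly on torsion (AEC VII.6.3
  transported along `ℚ_p ≅ ℚ_v`); extraction of a `p`-power annihilator in a `ℤ_p`-module;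
* §4 the local bound (L2), UNIFORM in the level: at every finite place `v` ONE `t ≠ 0` such that
  `t • c` satisfies the `n`-Selmer condition at `v` for every `n ≠ 0` and every class `c`
  unramified above `v` — seat `bsd-cn100-transfer-2`'s bad-place lemma
  `card_torsionPoints_nsmul_mem_selmerLocalKer_of_mem_unramifiedKer` (p483112) combined with
  `#E(K_v)[n] ∣ [E(K_v) : U]` for a torsion-free finite-index `U` (AEC VII.6.3).

References: K. Kato, Astérisque 295 (2004) §8.2 / Lemma 8.5, §14.1, (14.9.3); J.-P. Serre,
*Galois Cohomology* I §2.4; J. Milne, *ADT* I Lemma 2.10, Prop. 3.8, Lemma 3.3; J. Silverman,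
*AEC* VII.6.3, VIII.§2, X.§4.
-/

noncomputable section

open scoped Classical NumberField

open CategoryTheory Field IsDedekindDomain NumberField
open Literature.NumberTheory.GaloisRepresentations
open Literature.NumberTheory.EllipticCurves Literature.NumberTheory.EllipticCurves.Kato2004
open Literature.NumberTheory.EllipticCurves.Kato2004.EulerSystemValues
open WeierstrassCurve (geomPoints geomTorsion galH1Torsion selmerLocalKer selmerGroup torsionPoints
  torsionGaloisModule)

namespace Literature.NumberTheory.EllipticCurves.Kato2004

/-! ## §1 Plumbing on continuous `H¹`: `⊤` versus a subgroup containing everything -/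

section Top

variable {R : Type} [Ring R] [TopologicalSpace R] {G : Type} [Group G] [TopologicalSpace G]
  [IsTopologicalGroup G] (X : TopRep.{0} R G)

/-- Restriction `H¹(U, X) → H¹(⊤, X)` along `⊤ ≤ U` is injective when `U` contains every element of
`G` (the two subgroups coincide): a cocycle of `U` principal on `⊤` is principal.
[cite: SerreGaloisCohomology1997, I §2.4] -/
theorem eq_zero_of_resLe_top_eq_zero {U : Subgroup G} (hU : ∀ g : G, g ∈ U)
    (c : continuousCohomology 1 (subgroupRep X U))
    (hc : resLe X (show (⊤ : Subgroup G) ≤ U from fun g _ => hU g) 1 c = 0) : c = 0 := by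
  obtain ⟨ψ, rfl⟩ := oneCocycleClass_surjective _ c
  rw [resLe_oneCocycleClass] at hc
  obtain ⟨m, hm⟩ := (oneCocycleClass_eq_zero_iff _ _).mp hc
  refine (oneCocycleClass_eq_zero_iff _ _).mpr ⟨m, fun g => ?_⟩
  have h := hm ⟨g.1, trivial⟩
  simp only [contOneCocycles.pullback_apply] at h
  exact h

/-- `ofTopSubgroup : H¹(⊤, X) → H¹(G, X)` (pull-back along `G ≅ ⊤`) is injective: a cocycle of `⊤`
principal on `G` is principal. [cite: SerreGaloisCohomology1997, I §2.4] -/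
theorem eq_zero_of_ofTopSubgroup_eq_zero (c : continuousCohomology 1 (subgroupRep X ⊤))
    (hc : (ofTopSubgroup X 1).hom c = 0) : c = 0 := by
  obtain ⟨ψ, rfl⟩ := oneCocycleClass_surjective _ c
  have hc' : ContinuousCohomology.map toTopSubgroupHom (X := subgroupRep X ⊤) (Y := X)
      (TopRep.ofHom ⟨ContinuousLinearMap.id R X, fun _ => rfl⟩) 1 (oneCocycleClass _ ψ) = 0 := hc
  rw [map_oneCocycleClass] at hc'
  obtain ⟨m, hm⟩ := (oneCocycleClass_eq_zero_iff _ _).mp hc'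
  refine (oneCocycleClass_eq_zero_iff _ _).mpr ⟨m, fun g => ?_⟩
  have h := hm g.1
  simp only [contOneCocycles.pullback_apply] at h
  have hg : toTopSubgroupHom (G := G) g.1 = g := Subtype.ext rfl
  rw [hg] at h
  exact h

/-- Two successive restrictions are the restriction along the composite inclusion (on cocycles both
are `φ ↦ φ|_H`). [cite: SerreGaloisCohomology1997, I §2.4] -/
theorem resLe_resLe {H H' H'' : Subgroup G} (h : H ≤ H') (h' : H' ≤ H'')
    (c : continuousCohomology 1 (subgroupRep X H'')) :
    resLe X h 1 (resLe X h' 1 c) = resLe X (h.trans h') 1 c := by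
  obtain ⟨ψ, rfl⟩ := oneCocycleClass_surjective _ c
  rw [resLe_oneCocycleClass, resLe_oneCocycleClass, resLe_oneCocycleClass]
  exact congrArg _ (Subtype.ext (ContinuousMap.ext fun _ => rfl))

end Top

section LayerZero

variable (W : WeierstrassCurve ℚ) [W.IsElliptic] (p : ℕ) [Fact p.Prime]
  [ContinuousSMul ℤ_[p] (W.tateModule p)] (κ : ZpExtension ℚ p)

/-- `layerZeroToTop` carries integral classes to integral classes (the restrictions to the inertia
subgroups factor through it). [cite: Kato2004Asterisque, §8.2 and Lemma 8.5 (pp. 180–184)] -/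
theorem layerZeroToTop_mem_integralH1 {x : H1 (tateRep W p) (κ.layerSubgroup 0)}
    (hx : x ∈ integralH1 (tateRep W p) p (κ.layerSubgroup 0)) :
    layerZeroToTop W p κ x ∈ integralH1 (tateRep W p) p ⊤ := by
  rw [mem_integralH1_iff] at hx ⊢
  intro v hv 𝔓 h𝔓
  have h1 : (⊤ : Subgroup (absoluteGaloisGroup ℚ)) ⊓ 𝔓.inertia (absoluteGaloisGroup ℚ) ≤
      κ.layerSubgroup 0 ⊓ 𝔓.inertia (absoluteGaloisGroup ℚ) :=
    fun g hg => ⟨ZpExtension.mem_layerSubgroup_zero κ g, hg.2⟩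
  unfold layerZeroToTop
  rw [resLe_resLe, ← resLe_resLe (tateRep W p).toTopRep h1 inf_le_left, hx v hv 𝔓 h𝔓, map_zero]

/-- `layerZeroToTop` is injective. [cite: Kato2004Asterisque, §14.14 (14.14.1) (p. 243)] -/
theorem eq_zero_of_layerZeroToTop_eq_zero (x : H1 (tateRep W p) (κ.layerSubgroup 0))
    (hx : layerZeroToTop W p κ x = 0) : x = 0 :=
  eq_zero_of_resLe_top_eq_zero (tateRep W p).toTopRep (ZpExtension.mem_layerSubgroup_zero κ) x hx

/-- `layerZeroToTop` is `ℤ_p`-linear. [cite: Kato2004Asterisque, §14.14 (14.14.1) (p. 243)] -/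
theorem layerZeroToTop_smul (a : ℤ_[p]) (x : H1 (tateRep W p) (κ.layerSubgroup 0)) :
    layerZeroToTop W p κ (a • x) = a • layerZeroToTop W p κ x :=
  (layerZeroToTop W p κ).hom.map_smul a x

end LayerZero

/-! ## §2 The dialect bridge (L3): integral classes of `H¹(⊤, W[n])` are unramified away from `p` -/

section Bridge

variable (W : WeierstrassCurve ℚ) (p : ℕ)

/-- **(L3) Integral ⟹ unramified at every `𝔓 ∤ p`.** A class of `H¹(⊤, W[n])` lying in
`Kato2004.integralH1 … p ⊤` (its restriction to `⊤ ⊓ I_𝔓` vanishes for every prime `𝔓` of `ℤ̄`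
above a rational `v ≠ p`), moved to `H¹(Γ_ℚ, W[n])` by `ofTopSubgroup`, lies in
`unramifiedKer (W[n]) 𝔓` (its restriction to `I_𝔓` vanishes) — the same cocycle condition read in
the two dialects of the tree. [cite: Kato2004Asterisque, §8.2 and Lemma 8.5 (pp. 180–184)]
[cite: SilvermanAEC2009, VIII.§2 Definition p. 191] -/
theorem ofTopSubgroup_mem_unramifiedKer_of_mem_integralH1 (n : ℤ)
    {r : H1 (W.torsionGaloisModule n) ⊤} (hr : r ∈ integralH1 (W.torsionGaloisModule n) p ⊤)
    {v : HeightOneSpectrum (𝓞 ℚ)} (hv : ((Rat.HeightOneSpectrum.primesEquiv v : Nat.Primes) : ℕ) ≠ p)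
    {𝔓 : Ideal (absIntegers (𝓞 ℚ) ℚ)} (h𝔓 : 𝔓 ∈ v.primesAbove) :
    (ofTopSubgroup (W.torsionGaloisModule n).toTopRep 1).hom r ∈ unramifiedKer (geomTorsion W n) 𝔓 := by
  have h0 := (mem_integralH1_iff _ p ⊤ r).mp hr v hv 𝔓 h𝔓
  obtain ⟨ψ, rfl⟩ := oneCocycleClass_surjective _ r
  rw [resLe_oneCocycleClass] at h0
  obtain ⟨m, hm⟩ := (oneCocycleClass_eq_zero_iff _ _).mp h0
  have hc : (ofTopSubgroup (W.torsionGaloisModule n).toTopRep 1).hom (oneCocycleClass _ ψ) =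
      ContinuousCohomology.map toTopSubgroupHom (X := subgroupRep (W.torsionGaloisModule n).toTopRep ⊤)
        (Y := (W.torsionGaloisModule n).toTopRep)
        (TopRep.ofHom ⟨ContinuousLinearMap.id ℤ (geomTorsion W n), fun _ => rfl⟩) 1
        (oneCocycleClass _ ψ) := rfl
  rw [hc, map_oneCocycleClass]
  change oneCocycleClass (discreteTopRep (absoluteGaloisGroup ℚ) (geomTorsion W n)) _ ∈ _
  rw [unramifiedKer, oneCocycleClass_mem_subgroupResKer_iff]
  refine ⟨m, fun σ => ?_⟩
  exact hm ⟨σ.1, ⟨trivial, σ.2⟩⟩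

end Bridge

/-! ## §3 Small inputs -/

section Small

variable {K : Type} [Field K] [NumberField K] (W : WeierstrassCurve K)

omit [NumberField K] in
/-- A class of `H¹(K, E[n])` restricting to ZERO in `H¹(Γ_E, E[n])` satisfies the local Selmer
condition at `E` (it even dies in `H¹(E, E(Ē))`). [cite: SilvermanAEC2009, X.§4 diagram (**)] -/
theorem mem_selmerLocalKer_of_res_eq_zero (E : Type) [Field E] [Algebra K E] {n : ℤ}
    (c : galH1Torsion W n) (hc : galoisCohomology.res (W.torsionGaloisModule n) E 1 c = 0) :
    c ∈ selmerLocalKer W E n := by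
  obtain ⟨φ, rfl⟩ :=
    oneCocycleClass_surjective (discreteTopRep (absoluteGaloisGroup K) (geomTorsion W n)) c
  rw [WeierstrassCurve.res_torsionGaloisModule_oneCocycleClass] at hc
  obtain ⟨a, ha⟩ := (oneCocycleClass_eq_zero_iff _ _).mp hc
  rw [WeierstrassCurve.selmerLocalKer, oneCocycleClass_mem_resKer_iff]
  refine ⟨pointsMap W E (a : geomPoints W), fun σ => ?_⟩
  have h1 : φ.1 (resGal (K := K) E σ) = resGal (K := K) E σ • a - a := by
    rw [WeierstrassCurve.resGal_eq_absGaloisRestrict]; exact ha σ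
  change pointsMap W E ((φ.1 (resGal (K := K) E σ) : geomTorsion W n) : geomPoints W) = _
  rw [h1, AddSubgroupClass.coe_sub, map_sub,
    Literature.NumberTheory.EllipticCurves.AddSubgroup.torsionBy.coe_smul, pointsMap_smul]

/-- At an infinite place the `n`-Selmer local condition holds after multiplication by `2`
(`H¹(ℝ, ·)` is killed by `2`, `ℂ` has trivial Galois group; the torsion-coefficient twin of
`two_nsmul_mem_selmerLocalKerPrimary_infinitePlace`). [cite: SerreGaloisCohomology1997, I.§2.4 Cor. to Prop. 9] -/
theorem two_nsmul_mem_selmerLocalKer_infinitePlace (w : InfinitePlace K) {n : ℤ}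
    (c : galH1Torsion W n) : 2 • c ∈ selmerLocalKer W w.Completion n := by
  rw [WeierstrassCurve.selmerLocalKer_eq_comap, AddSubgroup.mem_comap, map_nsmul]
  exact two_nsmul_mem_localRestrictionKer_infinitePlace W w _

end Small

section Lambda

variable (W : WeierstrassCurve ℚ) [W.IsElliptic] (p : ℕ) [Fact p.Prime]

/-- **`λ : W(ℚ_v) → ℤ_p` vanishing exactly on torsion**, `v` the place of `ℚ` above `p`
(`ℚ_v = (primePlace p).adicCompletion ℚ`): Silverman AEC VII.6.3 for `W ⊗ ℚ_p` (tree theorem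
`exists_addMonoidHom_padicInt_apply_eq_zero_iff`) transported along the isomorphism `ℚ_v ≅ ℚ_p`
(`Padic.adicCompletionEquiv`; the induced map on points is an injective homomorphism).
[cite: SilvermanAEC2009, Prop. VII.6.3] -/
theorem exists_addMonoidHom_padicInt_adicCompletion :
    ∃ lam : (W.baseChange ((primePlace p).adicCompletion ℚ)).toAffine.Point →+ ℤ_[p],
      ∀ X, lam X = 0 ↔ IsOfFinAddOrder X := by
  obtain ⟨lam₀, hlam₀⟩ := exists_addMonoidHom_padicInt_apply_eq_zero_iff p (W.baseChange ℚ_[p])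
  let e : (primePlace p).adicCompletion ℚ →ₐ[ℚ] ℚ_[p] :=
    (Padic.adicCompletionEquiv (R := 𝓞 ℚ) ⟨p, Fact.out⟩).toAlgEquiv.symm.toAlgHom
  let f : (W.baseChange ((primePlace p).adicCompletion ℚ)).toAffine.Point →+
      (W.baseChange ℚ_[p]).toAffine.Point :=
    WeierstrassCurve.Affine.Point.map (W' := W) e
  have hf : Function.Injective f := WeierstrassCurve.Affine.Point.map_injective (W' := W) e
  refine ⟨lam₀.comp f, fun X => ?_⟩
  rw [AddMonoidHom.comp_apply, hlam₀]
  constructor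
  · intro h
    obtain ⟨m, hm, hmX⟩ := isOfFinAddOrder_iff_nsmul_eq_zero.mp h
    exact isOfFinAddOrder_iff_nsmul_eq_zero.mpr ⟨m, hm, hf (by rw [map_nsmul, map_zero]; exact hmX)⟩
  · intro h
    obtain ⟨m, hm, hmX⟩ := isOfFinAddOrder_iff_nsmul_eq_zero.mp h
    exact isOfFinAddOrder_iff_nsmul_eq_zero.mpr ⟨m, hm, by rw [← map_nsmul, hmX, map_zero]⟩

/-- In a `ℤ_p`-module, if a non-zero natural number `N` kills `y` then so does `p^{v_p(N)}`
(`N = p^j·u` with `p ∤ u`, and `u` is a unit of `ℤ_p`: Gouvêa, *p-adic Numbers*, Prop. 3.3.4 /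
the units of `ℤ_p` are the elements of norm `1`, Mathlib `PadicInt.isUnit_iff`).
[cite: SerreLocalFields1979, II.§3 (units of a complete discrete valuation ring)] -/
theorem exists_pow_smul_eq_zero_of_natCast_smul_eq_zero {M : Type} [AddCommGroup M] [Module ℤ_[p] M]
    {N : ℕ} (hN : N ≠ 0) (y : M) (hy : (N : ℤ_[p]) • y = 0) : ∃ j : ℕ, ((p : ℤ_[p]) ^ j) • y = 0 := by
  have hp : p.Prime := Fact.out
  obtain ⟨j, u, hu, rfl⟩ := Nat.exists_eq_pow_mul_and_not_dvd hN p hp.ne_one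
  refine ⟨j, ?_⟩
  have hunit : IsUnit ((u : ℕ) : ℤ_[p]) := by
    rw [PadicInt.isUnit_iff]
    have hle := PadicInt.norm_le_one ((u : ℕ) : ℤ_[p])
    have hlt : ¬ ‖((u : ℕ) : ℤ_[p])‖ < 1 := by
      rw [← Int.cast_natCast, PadicInt.norm_int_lt_one_iff_dvd, Int.natCast_dvd_natCast]
      exact hu
    exact le_antisymm hle (not_lt.mp hlt)
  obtain ⟨w, hw⟩ := hunit
  have h1 : (w⁻¹ : ℤ_[p]ˣ) • ((((p ^ j * u : ℕ) : ℤ_[p])) • y) = 0 := by rw [hy, smul_zero]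
  rw [Nat.cast_mul, Nat.cast_pow, mul_comm, mul_smul, ← hw, Units.smul_def, smul_smul,
    Units.inv_mul, one_smul] at h1
  exact h1

end Lambda

/-! ## §4 The uniform local bound (L2) at a finite place, from seat transfer-2's brick -/

section LocalBound

variable {K : Type} [Field K] [NumberField K] (W : WeierstrassCurve K) [W.IsElliptic]

/-- **(L2) A bounded exponent for unramified classes at a finite place, UNIFORM in the level.**
For an elliptic curve `E/K` and a finite place `v` there is ONE `t ≠ 0` (the index of a
torsion-free finite-index subgroup `U ≤ E(K_v)`, Silverman AEC VII.6.3 /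
`exists_finiteIndex_torsionFree_adicCompletion`) such that for every `n ≠ 0` every class of
`H¹(K, E[n])` unramified at the primes above `v` satisfies the `n`-Selmer local condition at `v`
after multiplication by `t`: seat `bsd-cn100-transfer-2`'s
`card_torsionPoints_nsmul_mem_selmerLocalKer_of_mem_unramifiedKer` (`#E(K_v)[n]` kills the
obstruction, Milne ADT I Lemma 2.10 / Prop. 3.8 at a bad place) and `#E(K_v)[n] ∣ [E(K_v) : U]`
(`E(K_v)[n]` injects into `E(K_v)/U`). [cite: MilneADT2006, Ch. I, Lemma 2.10 and Prop. 3.8]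
[cite: SilvermanAEC2009, Prop. VII.6.3] -/
theorem exists_uniform_nsmul_mem_selmerLocalKer_of_mem_unramifiedKer (v : HeightOneSpectrum (𝓞 K)) :
    ∃ t : ℕ, t ≠ 0 ∧ ∀ (n : ℤ), n ≠ 0 → ∀ c : galH1Torsion W n,
      (∀ 𝔓 ∈ v.primesAbove, c ∈ unramifiedKer (geomTorsion W n) 𝔓) →
        t • c ∈ selmerLocalKer W (v.adicCompletion K) n := by
  obtain ⟨U, hU, htf, -⟩ := W.exists_finiteIndex_torsionFree_adicCompletion v
  haveI := hU
  refine ⟨U.index, hU.index_ne_zero, fun n hn c hc => ?_⟩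
  obtain ⟨𝔓, h𝔓⟩ := v.primesAbove_nonempty
  have h1 := W.card_torsionPoints_nsmul_mem_selmerLocalKer_of_mem_unramifiedKer hn h𝔓 (hc 𝔓 h𝔓)
  -- `#E(K_v)[n] ∣ [E(K_v) : U]`: the `n`-torsion injects into `E(K_v)/U`
  have hdvd : Nat.card (torsionPoints W (v.adicCompletion K) n) ∣ U.index := by
    let f : torsionPoints W (v.adicCompletion K) n →+ _ ⧸ U :=
      (QuotientAddGroup.mk' U).comp (torsionPoints W (v.adicCompletion K) n).subtype
    have hf : Function.Injective f := by
      refine (injective_iff_map_eq_zero f).mpr fun a ha => ?_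
      have hmem : (a : (W.baseChange (v.adicCompletion K)).toAffine.Point) ∈ U :=
        (QuotientAddGroup.eq_zero_iff _).mp ha
      have hna : n • (a : (W.baseChange (v.adicCompletion K)).toAffine.Point) = 0 := by
        have h := a.2
        change (a : (W.baseChange (v.adicCompletion K)).toAffine.Point) ∈
          AddSubgroup.torsionBy _ n at h
        rw [AddSubgroup.torsionBy, Submodule.mem_toAddSubgroup, Submodule.mem_torsionBy_iff] at h
        exact h
      refine Subtype.ext (htf n.natAbs (Int.natAbs_ne_zero.mpr hn) _ hmem ?_)
      rw [← natCast_zsmul]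
      rcases Int.natAbs_eq n with h | h
      · rw [← h]; exact hna
      · rw [← neg_neg ((n.natAbs : ℤ)), ← h, neg_smul, hna, neg_zero]
    exact AddSubgroup.card_dvd_of_injective f hf
  obtain ⟨q, hq⟩ := hdvd
  rw [hq, mul_comm, mul_nsmul']
  exact AddSubgroup.nsmul_mem _ h1 q

end LocalBound

end Literature.NumberTheory.EllipticCurves.Kato2004

end
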